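import Summits.BirchSwinnertonDyer.Rank1Residual.WAll.TargetCMTwoRamifiedSMinus
import Summits.BirchSwinnertonDyer.Rank1Residual.P2.CongruentNumberSilentEvenFiveEnclosureDescent
import Summits.BirchSwinnertonDyer.Rank1Residual.P2.CornerFTwoPrintInterface
import HarnessLib

/-!
# Route `PrintCf2`, crux stmt-BirchSwinnertonDyer-20509 `RamifiedOffTYZOfFacts` — MONSKY'S FAMILY `𝒮⁻` CARVED OUT OF
# THE RESIDUAL AND CLOSED INSIDE THE FLAG-FREE BUNDLE; the registered stub `stub_offTYZ_residual` REDUCED to the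
# five-way residual (cell `bsd-print-cf2`, p1)

HONEST FRAMING (cell `bsd-print-cf2`; route `PrintCf2`; crux 20509 = `𝔅_ram → WAllCornerFTwoRamifiedOffTYZProved`, the
residual of the ramified type OFF the proved TYZ families, OPEN): the planner's birth skeleton cuts 20509 into
`stub_offTYZ_uPlusLeaf` (needs the ∃-display `tyz_genusPointData`, outside `𝔅_ram`; aside 20471 closed LITERAL-by-name),
`stub_offTYZ_atlasFJLeaf` (PROVED, p541735) and `stub_offTYZ_residual` (𝔅_ram → four-way residual
`WAllCornerFTwoRamifiedOffTYZ`; no print). This file takes ONE EXPLICIT INFINITE FAMILY out of that residual and closes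
it WITHIN `𝔅_ram`: Monsky's `𝒮⁻ = {E_{2pq} : p ≡ 5 (8), q ≡ 3 (4), (p/q) = −1}` (leaf `WAllCornerFTwoRamifiedSMinus` of
`WAll/TargetCMTwoRamifiedSMinus.lean`). The mathematics is cell `bsd-monsky`'s enclosure
`P2.congruentSilentEvenFiveBSDTwo_of_genusSystem_descent (hSys′)` — `ord_{s=1} L(E_{2pq}, s) = 1 ∧ BSD(E_{2pq}, 2)`
for every `(p, q)` of `𝒮⁻` from Tian's CM-point system on `𝒮⁻` with its printed properties in genus form
`hSys′ = tian2014_system_sMinus_genus` ALONE (conjunct 11 of `𝔅_ram`; Tian 2014 Thm 2.8 + the Gross–Zagier index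
relation + Gauss genus theory; the `2`-Selmer bound is a kernel theorem there) — moved to every
globally minimal `ℚ`-model by ty2's fact-free transport
`CornerFTwo.CongruentNumber.analyticRank_eq_one_and_bsdp_two_of_smul` (p534422). CONTENTS: the closer
`wAllCornerFTwoRamifiedSMinus_of_facts`; the NEW stub `stub_offTYZ_sMinusLeaf : 𝔅_ram → WAllCornerFTwoRamifiedSMinus`
(PROVED, signature in the registered stub grammar); the reduction of the REGISTERED stub
`stub_offTYZ_residual ⇐ (𝔅_ram → WAllCornerFTwoRamifiedOffTYZOffSMinus)` (five-way residual: off the three TYZ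
predicates AND off `𝒮⁻`); and the crux's conclusion from the reshaped stub set
(`offTYZProved_of_bundle_of_uPlus_of_atlasFJ_of_offSMinus`). No route file imported (bsd-wall T9: stubs are stated over
Literature facts and W-ALL leaves, verbatim). Nothing asserted; conditional on the displayed facts exactly as the item is.
Beyond print: YES — `BSD(E,2)` on `𝒮⁻` is Monsky's 1990 conjecture (Math. Z. 204, p. 67 Remark (3)); no printed proof;
a tree theorem modulo `hSys′`.
[cite: Monsky1990MockHeegner, p. 67 Remark (3)] [cite: Tian2014, Thm. 2.8] [cite: HeathBrown1994SelmerCongruentII,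
Appendix (Monsky), typescript p. 41 L20–L36] [cite: Miller2011LMS, Def. 1.1]
-/

noncomputable section

open scoped Classical

open Summit.BirchSwinnertonDyer Summit.BirchSwinnertonDyer.Rank1Residual
  Literature.NumberTheory.EllipticCurves

set_option autoImplicit false
namespace Summit.BirchSwinnertonDyer.PrintCf2

open Summit.BirchSwinnertonDyer.Rank1Residual.P2

/-- **CLOSER of the `𝒮⁻` leaf, modulo ONE conjunct of `𝔅_ram`**: Tian's CM-point system on `𝒮⁻` with its printed
properties in genus form (`hSys`, conjunct 11) gives `ord_{s=1} L(E_{2pq}, s) = 1 ∧ BSD(E_{2pq}, 2)` for every `(p, q)` of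
`𝒮⁻` — cell `bsd-monsky`'s `P2.congruentSilentEvenFiveBSDTwo_of_genusSystem_descent` (the `2`-Selmer input
`#Sel₂(E_{2pq}) ≤ 8` is a kernel theorem there; Heath-Brown 1994's even count, conjunct 10, is not even needed) — moved to
every globally minimal `ℚ`-model by ty2's fact-free transport
`CornerFTwo.CongruentNumber.analyticRank_eq_one_and_bsdp_two_of_smul`. The leaf's hypotheses `HasCM`, `r_an = 1`,
`CMRamified` are not used (they HOLD on the family). [cite: Tian2014, Thm. 2.8 (J132)]
[cite: TianYuanZhang2017, Thm. 3.3] [cite: Miller2011LMS, Def. 1.1 (arXiv:1010.2431 p. 3)] -/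
theorem wAllCornerFTwoRamifiedSMinus_of_facts (hSys : Tian2014.tian2014_system_sMinus_genus) :
    WAllCornerFTwoRamifiedSMinus := by
  intro W _ _ _ _ _ hmem
  obtain ⟨p, q, hp, hq, hp8, hq4, hj, C, hC⟩ := hmem
  exact (CornerFTwo.CongruentNumber.analyticRank_eq_one_and_bsdp_two_of_smul
    (squarefree_two_mul_mul_of_sMinus hp hq hp8 hq4)
    (congruentSilentEvenFiveBSDTwo_of_genusSystem_descent hSys p q hp hq hp8 hq4 hj) hC).2

/-- **NEW STUB `stub_offTYZ_sMinusLeaf` of the reshaped skeleton of crux 20509, PROVED inside 𝔅_ram** (fact used: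
conjunct 11 = `tian2014_system_sMinus_genus`; signature in the registered stub grammar `𝔅_ram → <W-ALL leaf>`).
[cite: Tian2014, Thm. 2.8 (J132)] [cite: TianYuanZhang2017, Thm. 3.3] -/
theorem stub_offTYZ_sMinusLeaf : (Literature.NumberTheory.EllipticCurves.rank_eq_analyticRank_of_analyticRank_le_one ∧ WeierstrassCurve.hasEntireLFunction_rat ∧ WeierstrassCurve.bsdRHS_eq_of_isIsogenous ∧ Literature.NumberTheory.EllipticCurves.bsdTriple_of_hasCM_of_L_one_ne_zero ∧ Literature.NumberTheory.EllipticCurves.TianYuanZhang2017.thm12_parity_of_scriptL' ∧ Literature.NumberTheory.EllipticCurves.Tian2014.thm13_rank_one_and_sha_odd ∧ Literature.NumberTheory.QuadraticFields.RedeiReichardt.redeiReichardt_fourTwoCard_classGroup ∧ Literature.NumberTheory.EllipticCurves.LiLiuTian2024.thm12_bsd_congruentNumberCurve ∧ Literature.NumberTheory.EllipticCurves.Monsky1990.cor515_rank_eq_one_and_card_selmerGroup_two ∧ Literature.NumberTheory.EllipticCurves.HeathBrown1994.monsky_card_selmerGroup_two_even ∧ Literature.NumberTheory.EllipticCurves.Tian2014.tian2014_system_sMinus_genus)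 → Summit.BirchSwinnertonDyer.WAllCornerFTwoRamifiedSMinus :=
  fun hB ↦ wAllCornerFTwoRamifiedSMinus_of_facts hB.2.2.2.2.2.2.2.2.2.2

/-- **The REGISTERED stub `stub_offTYZ_residual` (𝔅_ram ⟹ four-way residual) REDUCES to the five-way residual**
(`𝔅_ram ⟹ WAllCornerFTwoRamifiedOffTYZOffSMinus`), the `𝒮⁻` part being proved. [folklore] -/
theorem stub_offTYZ_residual_of_offSMinus
    (hO : (Literature.NumberTheory.EllipticCurves.rank_eq_analyticRank_of_analyticRank_le_one ∧ WeierstrassCurve.hasEntireLFunction_rat ∧ WeierstrassCurve.bsdRHS_eq_of_isIsogenous ∧ Literature.NumberTheory.EllipticCurves.bsdTriple_of_hasCM_of_L_one_ne_zero ∧ Literature.NumberTheory.EllipticCurves.TianYuanZhang2017.thm12_parity_of_scriptL' ∧ Literature.NumberTheory.EllipticCurves.Tian2014.thm13_rank_one_and_sha_odd ∧ Literature.NumberTheory.QuadraticFields.RedeiReichardt.redeiReichardt_fourTwoCard_classGroup ∧ Literature.NumberTheory.EllipticCurves.LiLiuTian2024.thm12_bsd_congruentNumberCurve ∧ Literature.NumberTheory.EllipticCurves.Monsky1990.cor515_rank_eq_one_and_card_selmerGroup_two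 ∧ Literature.NumberTheory.EllipticCurves.HeathBrown1994.monsky_card_selmerGroup_two_even ∧ Literature.NumberTheory.EllipticCurves.Tian2014.tian2014_system_sMinus_genus) → Summit.BirchSwinnertonDyer.WAllCornerFTwoRamifiedOffTYZOffSMinus) :
    (Literature.NumberTheory.EllipticCurves.rank_eq_analyticRank_of_analyticRank_le_one ∧ WeierstrassCurve.hasEntireLFunction_rat ∧ WeierstrassCurve.bsdRHS_eq_of_isIsogenous ∧ Literature.NumberTheory.EllipticCurves.bsdTriple_of_hasCM_of_L_one_ne_zero ∧ Literature.NumberTheory.EllipticCurves.TianYuanZhang2017.thm12_parity_of_scriptL' ∧ Literature.NumberTheory.EllipticCurves.Tian2014.thm13_rank_one_and_sha_odd ∧ Literature.NumberTheory.QuadraticFields.RedeiReichardt.redeiReichardt_fourTwoCard_classGroup ∧ Literature.NumberTheory.EllipticCurves.LiLiuTian2024.thm12_bsd_congruentNumberCurve ∧ Literature.NumberTheory.EllipticCurves.Monsky1990.cor515_rank_eq_one_and_card_selmerGroup_two ∧ Literature.NumberTheory.EllipticCurves.HeathBrown1994.monsky_card_selmerGroup_two_even ∧ Literature.NumberTheory.EllipticCurves.Tian2014.tian2014_system_sMinus_genus)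 → Summit.BirchSwinnertonDyer.WAllCornerFTwoRamifiedOffTYZ :=
  fun hB ↦ wAllCornerFTwoRamifiedOffTYZ_of_sMinus_of_offSMinus (stub_offTYZ_sMinusLeaf hB) (hO hB)

/-- **The crux's conclusion from the reshaped stub set** — U⁺ leaf, `𝒮⁻` (proved), five-way residual; the FJ-atlas leaf
is the landed `stub_offTYZ_atlasFJLeaf` (p541735) and enters as a hypothesis here only to keep this file independent
of that module. [folklore] -/
theorem offTYZProved_of_bundle_of_uPlus_of_atlasFJ_of_offSMinus
    (hB : Literature.NumberTheory.EllipticCurves.rank_eq_analyticRank_of_analyticRank_le_one ∧ WeierstrassCurve.hasEntireLFunction_rat ∧ WeierstrassCurve.bsdRHS_eq_of_isIsogenous ∧ Literature.NumberTheory.EllipticCurves.bsdTriple_of_hasCM_of_L_one_ne_zero ∧ Literature.NumberTheory.EllipticCurves.TianYuanZhang2017.thm12_parity_of_scriptL' ∧ Literature.NumberTheory.EllipticCurves.Tian2014.thm13_rank_one_and_sha_odd ∧ Literature.NumberTheory.QuadraticFields.RedeiReichardt.redeiReichardt_fourTwoCard_classGroup ∧ Literature.NumberTheory.EllipticCurves.LiLiuTian2024.thm12_bsd_congruentNumberCurve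 ∧ Literature.NumberTheory.EllipticCurves.Monsky1990.cor515_rank_eq_one_and_card_selmerGroup_two ∧ Literature.NumberTheory.EllipticCurves.HeathBrown1994.monsky_card_selmerGroup_two_even ∧ Literature.NumberTheory.EllipticCurves.Tian2014.tian2014_system_sMinus_genus)
    (hU : WAllCornerFTwoRamifiedTYZUPlus) (hF : WAllCornerFTwoRamifiedTYZAtlasFJ)
    (hO : WAllCornerFTwoRamifiedOffTYZOffSMinus) : WAllCornerFTwoRamifiedOffTYZProved :=
  wAllCornerFTwoRamifiedOffTYZProved_of_uPlus_of_atlasFJ_of_sMinus_of_offSMinus hU hF (stub_offTYZ_sMinusLeaf hB) hO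

end Summit.BirchSwinnertonDyer.PrintCf2

end
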